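import Summits.QuantumFields.BalabanUV.T4Continuum.Support.NE9LinSizeEndRemSpecies
import Summits.QuantumFields.BalabanUV.T4Continuum.Support.NE9Lemma1RemainderSpeciesAdditive

/-!
# NE9LinSizeEndRemSpeciesAdd — E5′-REM-ADD: the d-currency torus END face of row NE9 at the DISPLAYED SPECIES on the analytic
class with ALL FOUR channel-structure binders S2 / S3 / S4 / S5 DISCHARGED BY THE KERNEL — E5′-REM (`NE9LinSizeEndRemSpecies`,
p213078, this seat) with its one displayed structural binder `PieceAdditiveOn (analyticClass R) Dd.toC` supplied by crew row (w16)
`NE9Lemma1RemainderSpeciesAdditive.pieceAdditiveOn_rem` (leaf-08-g4, p213082) BY NAME (cell `pub-balaban`, T4-DAG §2 node U3 / §6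
NE9; rung (B)+1 on a FIXED finite T⁴; NE9 formalisation crew, unit `b2b-balaban-t4-ne9-formalise-leaf-07` gen 4; nothing of either
import modified, no END re-wired)

HONEST FRAMING (T4-DAG PAGE 1).  Rung (B)+1 = existence and uniqueness of the ε → 0 limit of gauge-invariant observables on a
FIXED finite torus T⁴ — NOT infinite volume, NOT a mass gap, NOT the Clay problem.  NE9 is a cell NEW ESTIMATE, NOT PRINTED and
NOT discharged here («NE9 ⇐ the named binders»).  Everything kernel here is FORM-LEVEL: the species is the owner's `RemData.toC`
(the (1.23) contour functional of the fifth-order Taylor remainder along displayed contour directions, re/im-doubled carriers);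
its identification with Bałaban's (1.23)/(1.33) pieces is O-NE9-1 (NODE O), NOT claimed.  DISPLAYED on the channel side after
this file (binders, never asserted): the datum's admissibility `RemData.Admissible` (κ₁ ≥ 1, radii, `‖dir‖ ≤ dirB < R_X`,
`dirB ≤ c_dir·ℓ·R_X` = the DOMAIN INCLUSION [I] (3.36) p. 277, source discipline, G1 = [II] (1.25)); the DIRECTION REGULARITY pair
`hdirC` (joint continuity of `(t, s, σ) ↦ dir … t s σ`) / `hdirR` (`‖dir‖ < R_X` everywhere) — TYPE [II] (1.21)/(1.23) p. 7 (the
directions are built from the s-interpolated operators 𝐇_k(s(Y₀), B′)); S1 `AdmissibleTerms E W (analyticClass R)` ([I] (1.18)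
p. 263: the renormalised terms are analytic on 𝔘^c_j — TYPE); the level counts `LevelCountsG` of [II] p. 8 on the species' index
frame; `Factorises` / `LastCouplingLipschitz` at `cpieceChannel Dd.toC`; every activity / geometry / (A″) / (L‴) binder of E5′
VERBATIM.  0 `def`, 0 `sorry`; [I]/[II] locators are TYPE locators (ABSOLUTE RULE); `FlowStep.BetaPertH`, (B), (B^μ) do not occur.
HONEST DEPENDENCY (verbatim): continuum YM on T⁴ ⇐ BetaPertH ∧ nine spine estimates (0/9 proved); BetaPertH ⇐ (D1) ∧ (D4) ∧
CAP+tail; G-an2-4 gates asym, D1 and NE2/3/4.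

WHAT IS PROVED (kernel).
§1 **E5′-REM-ADD `torus_termSize_ne9_and_fadingMemory_of_linSizeDischargers_remSpeciesAdd`** — E5′-REM with
   `hA := pieceAdditiveOn_rem Dd (0 < κ₁ ⇐ hD.κ₁_ge) hD.r_pos hdirC hdirR`.  The channel side of the d-currency END then carries NO
   abstract S-binder: S2 (`admRestrict_analyticClass`), S3 (`pieceAdditiveOn_rem` ∘ `channelAdditive_cpiece`), S4/step-sum
   (`channelStepSum_cpiece`), S5 (`pieceBoundOnG_rem` ∘ `channelSizeAtStepNN_cpieceG`) and the profile are all BY NAME; displayed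
   remain the datum's TYPE admissibility + direction regularity, S1, the p. 8 counts, the letters `0 ≤ O1`, `0 ≤ c_Q`, `0 < ω`.
   Conclusion LITERALLY E5′-πG's root with **`μ = ω + 4·lipbar·(a₁·e^{−a″(ν+1)})·c_Q`**.
DISGUISE TEST: one-history statements about a linear channel of ONE run at a FORM-level species; S5 is the fading SOURCE, not
NE9; nothing is asserted about Bałaban's 𝐇_k, 𝔘^c_j or (1.33).

References (TYPE locators only; nothing printed is a hypothesis): T. Bałaban, CMP **109** (1987) [Balaban1987RG1] (1.18) p. 263,
(3.36) p. 277, (3.54) p. 280; CMP **116** (1988) [Balaban1988RG2Cluster] (1.10) p. 4, (1.21)–(1.29) pp. 7–8, (1.33) p. 9, (2.27)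
p. 18, (2.38) p. 20, (2.41) p. 21; R. Kotecký, D. Preiss, CMP **103** (1986) [KoteckyPreiss1986].
-/

noncomputable section

namespace Summit.QuantumFields.BalabanUV.T4Continuum.NE9LinSizeEndRemSpeciesAdd

open scoped BigOperators
open Metric Set MeasureTheory BoundedContinuousFunction
open Literature.Probability.LatticeModels
open Literature.MathematicalPhysics.QuantumFieldTheory
open Literature.MathematicalPhysics.QuantumFieldTheory.Balaban1983to89
open Literature.MathematicalPhysics.QuantumFieldTheory.Balaban1983to89.T4OutputRate
open Literature.MathematicalPhysics.QuantumFieldTheory.Balaban1983to89.T4ActivityLipschitz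
open Literature.MathematicalPhysics.QuantumFieldTheory.Balaban1983to89.T4HistoryLipschitzRecursion
open Literature.MathematicalPhysics.QuantumFieldTheory.Balaban1983to89.T4HistoryLipschitzOuter
open Literature.MathematicalPhysics.QuantumFieldTheory.Balaban1983to89.T4HistoryLipschitzActivity
open Literature.MathematicalPhysics.QuantumFieldTheory.Balaban1983to89.T4HistoryLipschitzEntropy
open Literature.MathematicalPhysics.QuantumFieldTheory.Balaban1983to89.T4HistoryLipschitzCubeGeometry
open Literature.MathematicalPhysics.QuantumFieldTheory.Balaban1983to89.T4HistoryLipschitzActivity (ClusterGeom)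
open Literature.MathematicalPhysics.QuantumFieldTheory.Balaban1983to89.T4HistoryLipschitzSegment
open Literature.MathematicalPhysics.QuantumFieldTheory.Balaban1983to89.T4HistoryLipschitzLinearSize
open Summit.QuantumFields.BalabanUV.T4Continuum.NE9Lemma1Counting
open Summit.QuantumFields.BalabanUV.T4Continuum.NE9Lemma1Gain
open Summit.QuantumFields.BalabanUV.T4Continuum.NE9Lemma1PieceClass
open Summit.QuantumFields.BalabanUV.T4Continuum.NE9ComplexEncoding (doubleCarriers)
open Summit.QuantumFields.BalabanUV.T4Continuum.NE9Lemma1RemainderSpecies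
open Summit.QuantumFields.BalabanUV.T4Continuum.NE9Lemma1RemainderSpeciesAdditive (pieceAdditiveOn_rem)
open Summit.QuantumFields.BalabanUV.T4Continuum.NE9LinSizeEnd
open Summit.QuantumFields.BalabanUV.T4Continuum.NE9LinSizeEndRemSpecies

variable {ν N : ℕ} {C : Carriers} {D : ℕ}
variable {Bg : Type} [NormedAddCommGroup Bg] [NormedSpace ℂ Bg] {Sp : Type*} [TopologicalSpace Sp] [MeasurableSpace Sp]
  [OpensMeasurableSpace Sp] {F : Type*} [Fintype F] {Ω : Type*} [MeasurableSpace Ω]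

/-! ## §1 E5′-REM-ADD: all four channel-structure binders kernel for the displayed species -/

/-- **E5′-REM-ADD — E5′ AT THE DISPLAYED SPECIES WITH S2/S3/S4/S5 KERNEL (composition BY NAME).**  `NE9LinSizeEndRemSpecies.
torus_termSize_ne9_and_fadingMemory_of_linSizeDischargers_remSpecies` with its displayed additivity binder supplied by (w16):
`hA := pieceAdditiveOn_rem Dd _ hD.r_pos hdirC hdirR` (`0 < κ₁` from `hD.κ₁_ge : 1 ≤ κ₁`).  DISPLAYED instead: the DIRECTION
REGULARITY pair `hdirC`/`hdirR` (TYPE [II] (1.21)/(1.23) p. 7), beside `hD` (the datum's TYPE admissibility), S1 `hAdm`, the p. 8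
counts `hLev` and the letters; every activity / geometry / (A″) / (L‴) binder of E5′ VERBATIM.  Conclusion: E5′-πG's root with
**`μ = ω + 4·lipbar·(a₁·e^{−a″(ν+1)})·c_Q`**.
[cite: Balaban1987RG1, (1.18) p.263, (3.36) p.277, (3.54) p.280; Balaban1988RG2Cluster, (1.21)-(1.29) pp.7-8, (1.33) p.9, (2.27) p.18, (2.38) p.20, (2.41) p.21; KoteckyPreiss1986, (1)-(3)] -/
theorem torus_termSize_ne9_and_fadingMemory_of_linSizeDischargers_remSpeciesAdd
    (Γ : CubeChart (doubleCarriers C) (Fin ν → ZMod N) (torusAdj ν N) D) {ι αi βi γi δ : Type} [DecidableEq δ]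
    (Dd : RemData C Bg ι αi βi γi δ) {ℓr : ℕ → ℕ → ℝ} {cdir d0 : ℝ}
    {E : Functional (doubleCarriers C) Bg} {W : Set (ℕ → ℝ)}
    {Ψ : ℕ → ℝ → (ι → ℝ) → Bg → (doubleCarriers C).Dom → ℝ}
    {μ : ℕ → ℝ → Bg → Finset (Fin ν → ZMod N) → Measure Ω} {pre : ℕ → ℝ → Bg → Finset (Fin ν → ZMod N) → Ω → ℂ}
    {c : ℕ → ℝ → Bg → Finset (Fin ν → ZMod N) → Ω → F → ℂ}
    {pt : ℕ → ℝ → Bg → Finset (Fin ν → ZMod N) → Ω → F → Sp} {β : ℕ → Sp → ℝ}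
    {dom : ℕ → Finset (Fin ν → ZMod N) → F → Finset (Fin ν → ZMod N)}
    {lip ε' α4 : ℕ → ℝ} {a₁ a'' κ O1 cQ ω lipbar ℓ a a' : ℝ}
    {lam p₀ Nsz : ℕ → ℝ}
    (ρ : ℕ → (ι → ℝ) → (Sp →ᵇ ℂ))
    -- the DISPLAYED SPECIES: its datum is admissible ((I.3.36) domain inclusion, radii, G1 — TYPE), the scale letter ℓ ≥ 0
    (hD : Dd.Admissible ℓr cdir d0) (hℓr : ∀ k j, 0 ≤ ℓr k j)
    -- S1 (the renormalised terms lie in the ANALYTIC class — [I] (1.18) p. 263, TYPE) and scale-zero freeness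
    (h0 : ScaleZeroFree E W) (hAdm : AdmissibleTerms E W (analyticClass Dd.R))
    -- S3: DIRECTION REGULARITY of the contour directions (TYPE [II] (1.21)/(1.23) p. 7) — the residue of (w16)'s additivity
    (hdirC : ∀ k s y a b x, Continuous fun p : ℂ × (δ → ℝ) × (δ → ℂ) => Dd.dir k s y a b x p.1 p.2.1 p.2.2)
    (hdirR : ∀ k s y a b x t s' σ', ‖Dd.dir k s y a b x t s' σ'‖ < Dd.R x.1)
    -- the level counts of [II] p. 8 on the species' index frame, against `c_Q·ω^{k−j}` (displayed), and the letters
    (hLev : LevelCountsG Dd.toC.frame κ Dd.κ₁ O1 cQ (fun k j => ℓr k j ^ 5) (agePow ω))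
    (hO1 : 0 ≤ O1) (hcQ : 0 ≤ cQ) (hω : 0 < ω)
    -- E5′'s remaining recursion-side binders at `T := cpieceChannel Dd.toC`, `wt := weightOf Dd.toC.frame Dd.κ₁ d0 O1 (KpOf Dd cdir)`
    (hfac : Factorises E W (cpieceChannel Dd.toC) Ψ) (hlast : LastCouplingLipschitz E W (cpieceChannel Dd.toC) Ψ κ lam)
    (hρ : ∀ (k : ℕ) (Q Q' : ι → ℝ) (M : ℝ), (∀ y, |Q y - Q' y| ≤ weightOf Dd.toC.frame Dd.κ₁ d0 O1 (KpOf Dd cdir) k y * M) →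
      ‖ρ k Q - ρ k Q'‖ ≤ M)
    (hΨ : ∀ (k : ℕ) (s : ℝ) (Q Q' : ι → ℝ) (U : Bg) (X : (doubleCarriers C).Dom),
      Ψ k s Q U X - Ψ k s Q' U X =
        (Γ.geom.newTerm (Γ.geom.avgExpLinearAct μ pre fun k s U γ ω => evalFunctional (c k s U γ ω) (pt k s U γ ω))
            k s U X (ρ k Q) -
          Γ.geom.newTerm (Γ.geom.avgExpLinearAct μ pre fun k s U γ ω => evalFunctional (c k s U γ ω) (pt k s U γ ω))
            k s U X (ρ k Q')).re)
    (hexpl : ∀ g ∈ W, ∀ (k : ℕ) (Q : ι → ℝ) (U : Bg) (X : (doubleCarriers C).Dom), (doubleCarriers C).scale X = k + 1 →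
      |Ψ k (g k) Q U X -
          (Γ.geom.newTerm (Γ.geom.avgExpLinearAct μ pre fun k s U γ ω => evalFunctional (c k s U γ ω) (pt k s U γ ω))
            k (g k) U X (ρ k Q)).re| ≤ Real.exp (-(κ * (doubleCarriers C).d X)) * p₀ k)
    (hbase : ∀ g ∈ W, ∀ (U : Bg) (X : (doubleCarriers C).Dom), (doubleCarriers C).scale X = 0 → |E g U X| ≤ Real.exp (-(κ * (doubleCarriers C).d X)) * Nsz 0)
    (hNsucc : ∀ j, p₀ j + a₁ * Real.exp (-(a'' * (ν + 1))) ≤ Nsz (j + 1)) (hNnn : ∀ j, 0 ≤ Nsz j)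
    (hbox : ∀ (k : ℕ) (Q : ι → ℝ),
      (∀ y, |Q y| ≤ weightOf Dd.toC.frame Dd.κ₁ d0 O1 (KpOf Dd cdir) k y * sizeRadius (tauOfG cQ (agePow ω)) Nsz k) → ∀ x, ‖ρ k Q x‖ ≤ β k x)
    (hpre : ∀ k s U γ, AEStronglyMeasurable (pre k s U γ) (μ k s U γ))
    (hc : ∀ k s U γ Y, AEStronglyMeasurable (fun ω => c k s U γ ω Y) (μ k s U γ))
    (hpt : ∀ k s U γ Y, Measurable fun ω => pt k s U γ ω Y) (hlip : ∀ k, 0 < lip k) (hlipb : ∀ k, lip k ≤ lipbar)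
    (hint₀ : ∀ k s U γ, Integrable (fun ω => ‖pre k s U γ ω‖ * Real.exp (boxExponent c pt β k s U γ ω)) (μ k s U γ))
    (hmeet : ∀ k s U (γ : Finset (Fin ν → ZMod N)) ω Y, c k s U γ ω Y ≠ 0 → ∃ x ∈ γ, x ∈ dom k γ Y)
    (hα4 : ∀ k, 0 ≤ α4 k) (ha : (2:ℝ) ^ ν * Real.log 2 + Real.log (8 * ν) ≤ a)
    (hliplb : ∀ k, α4 k * 2 ^ (ν + 1 + 2 ^ ν) ≤ lip k)
    (hlin : ∀ k s U (γ : Finset (Fin ν → ZMod N)) ω Y,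
      ‖c k s U γ ω Y‖ ≤ α4 k * Real.exp (-(a * (linSize (dom k γ Y) : ℝ))))
    (hdomconn : ∀ k (γ : Finset (Fin ν → ZMod N)) Y, (dom k γ Y).Nonempty →
      ∃ b ∈ dom k γ Y, Polymer.IsConn (torusAdj ν N) (dom k γ Y) b)
    (hdominj : ∀ k (γ : Finset (Fin ν → ZMod N)), Set.InjOn (dom k γ) {Y | (dom k γ Y).Nonempty})
    (hXconn : ∀ X, ∃ b, Polymer.IsConn (torusAdj ν N) (Γ.cubes X) b)
    (hcmp : ∀ X, κ * (doubleCarriers C).d X ≤ a'' * (linSize (Γ.cubes X) : ℝ))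
    (hε' : ∀ k, 0 ≤ ε' k)
    (hdecayLin : ∀ g ∈ W, ∀ (k : ℕ) (U : Bg) (X : (doubleCarriers C).Dom), (doubleCarriers C).scale X = k + 1 → ∀ γ' ∈ Γ.vol X,
      ∫ ω, ‖pre k (g k) U γ' ω‖ * Real.exp (boxExponent c pt β k (g k) U γ' ω) ∂(μ k (g k) U γ') ≤
        ε' k * Real.exp (-(a' * (linSize γ' : ℝ))))
    (ha₁ : 0 ≤ a₁) (ha'' : 0 ≤ a'')
    (hrate : (2:ℝ) ^ ν * Real.log 2 + Real.log (8 * ν) ≤ a' - a'' - 2 ^ ν * (a₁ + Real.log 2))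
    (hsmall : ∀ k, ((D : ℝ) + 1) * (2 * ε' k) * Real.exp (a'' * (ν + 1) + 2 ^ ν * (a₁ + Real.log 2)) *
      2 ^ (ν + 1 + 2 ^ ν) ≤ a₁)
    (hℓ : 0 ≤ ℓ) (hlam : ∀ k, lam k ≤ ℓ) :
    TermSize E W κ Nsz ∧
      NE9 E W κ (prodModuli ℓ fun _ => ω + 4 * lipbar * (a₁ * Real.exp (-(a'' * (ν + 1)))) * cQ) ∧
        FadingMemory (ℓ / (ω + 4 * lipbar * (a₁ * Real.exp (-(a'' * (ν + 1)))) * cQ))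
          (ω + 4 * lipbar * (a₁ * Real.exp (-(a'' * (ν + 1)))) * cQ)
          (prodModuli ℓ fun _ => ω + 4 * lipbar * (a₁ * Real.exp (-(a'' * (ν + 1)))) * cQ) :=
  -- S3 for the species: `PieceAdditiveOn (analyticClass R) Dd.toC` from (w16) BY NAME (κ₁ > 0 and r_k > 0 are in the datum's
  -- admissibility), then §1 of `NE9LinSizeEndRemSpecies`
  torus_termSize_ne9_and_fadingMemory_of_linSizeDischargers_remSpecies Γ Dd ρ hD hℓr h0 hAdm
    (pieceAdditiveOn_rem Dd (lt_of_lt_of_le zero_lt_one hD.κ₁_ge) hD.r_pos hdirC hdirR) hLev hO1 hcQ hω hfac hlast hρ hΨ hexpl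
    hbase hNsucc hNnn hbox hpre hc hpt hlip hlipb hint₀ hmeet hα4 ha hliplb hlin hdomconn hdominj hXconn hcmp hε' hdecayLin ha₁ ha''
    hrate hsmall hℓ hlam

end Summit.QuantumFields.BalabanUV.T4Continuum.NE9LinSizeEndRemSpeciesAdd

end
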